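import Literature.AlgebraicGeometry.Surfaces.K3Surface
import HarnessLib

/-!
# van Geemen–Schütt: families of K3 surfaces whose real multiplication is induced by an algebraic
# cycle (graphs of a dihedral automorphism; graphs of rational self-maps)

Topic `Literature/AlgebraicGeometry/Surfaces` (family `hodge`). Source: B. van Geemen, M. Schütt,
*On families of K3 surfaces with real multiplication*, Forum Math. Sigma **13** (2025) e2 =
arXiv:2310.05196 [GeemenSchutt2023] (arXiv text read this session; locators = its numbering, which
is that of the version of record). Ledger cite item `wi-74487` (consumer: the K3-square crux
`stmt-HodgeConjecture-19652`, line "cm-anchor-spread": members with `End_Hdg T(S) = F` and an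
ALGEBRAIC generator of `F` give `HC⁴(S × S)`).

## The printed statements

* §1, before Thm. 1.1 (p. 3): "a family of K3 surfaces has RM (or CM) by a field `F` if the very
  general member `X` in the family has `F = End_Hod(T_{X,ℚ})`. The K3 surfaces considered in this
  paper are all algebraic."
* **Thm. 1.1**: "(7) The 3-dimensional family of elliptic K3 surfaces in §5.3 has `ρ = 4` and RM by
  the cubic field `ℚ(ζ₇+ζ₇⁻¹)`. (9) The 2-dimensional family of elliptic K3 surfaces in §5.5 has
  `ρ = 10` and RM by the cubic field `ℚ(ζ₉+ζ₉⁻¹)`. (11) The 2-dimensional family of elliptic K3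
  surfaces in §5.7 has `ρ = 2` and RM by the degree five field `ℚ(ζ₁₁+ζ₁₁⁻¹)`." ((5): the
  7-dimensional family of DEGREE-2 K3 surfaces of §5.9, `ρ = 2`, RM by `ℚ(√5)` — not an elliptic
  `𝓔_a`-family; see "NOT here".) §5.2 (elliptic, `n = 5`): the 4-dimensional family `X_a` (base
  change of the rational elliptic surface `y² = x³ + a₁x + a₂` by `t = p_{5,a}(s)`) has very general
  `ρ = 6` and "`ℚ(√5) ⊂ End_Hod(T_{X_a,ℚ})` … this is an equality very generally".
* **Prop. 4.6 / §4.7** (the surfaces `𝓔_a : Y² = X³ + α(p_{n,a}(x))X + β(p_{n,a}(x))`, `p_{n,a}` the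
  Dickson polynomial, `n ∈ {5,7,11}`; §5.6 the same deformation `t⁹ ↦ p_{9,a}` for `n = 9`): the
  pull-back `𝓔̃_a` along `x = v + a/v` carries the dihedral group `D_n = ⟨σ, τ⟩`,
  `σ(X,Y,v) = (X,Y,ζ_n v)`, and `σ^* + (σ⁻¹)^*` generates `F = ℚ(ζ_n+ζ_n⁻¹) ⊂ End_Hod(T_{𝓔_a})`.
* **§4.8 "Cycles inducing the real multiplication"** (p. 10): "let `Γ_k := {(x, σᵏ(x))} ⊂ 𝓔̃_a × 𝓔̃_a`
  be the graph of the order `n` automorphism `σ ∈ D_n` of `𝓔̃_a` … The endomorphism of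
  `H²(𝓔̃_a, ℚ)` defined by the Künneth component `[Γ_k]₂` lies in `End_Hod(H²(𝓔̃_a, ℚ))` … and one
  has `[Γ_k]₂ = (σ⁻ᵏ)^*` … In particular, the action of `ζ_n+ζ_n⁻¹` on `H²(𝓔̃_a, ℚ)` is induced by
  the cycle `Γ₁+Γ₋₁` on `𝓔̃_a × 𝓔̃_a`. This cycle induces one on `𝓔_a × 𝓔_a` which defines the real
  multiplication on `T_{X,ℚ}`." Remark 4.9: "In general, if `X` is a K3 surface with RM by
  `ℚ(ζ_m+ζ_m⁻¹)`, then there is a priori no reason to assume that the real multiplication is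
  induced by a cycle with two irreducible components as we found for the `𝓔_a`."
* **Thm. 1.2**: "(2) The 4-dimensional family of elliptic K3 surfaces in Proposition 6.2 has `ρ = 10`
  and RM by `ℚ(√2)`. (3) The 3-dimensional family of elliptic K3 surfaces in Proposition 7.2 has
  `ρ = 10` and RM by `ℚ(√3)`." §6 (p. 13): "in order to find K3 surfaces with RM (induced by
  suitable rational self-maps)"; proof §6.4: the degree-`2` isogeny `ψ : X ⇢ X'` composed with the
  isomorphism `φ' : X' ≅ X`, `(u,v,t) ↦ (2x, 2√2 y, −t)`, is "a self-map `φ'∘ψ` of `X` of degree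
  `2`"; "`ℚ(√2) ⊂ End_Hod(T_X)` by inspection of the degree `2` self-map `φ'∘ψ` of `X` and its
  induced action on `ω`" (`ω = dx ∧ dt/y` is multiplied by `√2`; very generally `ρ = 10` and the
  endomorphism field is exactly quadratic, end of §6.4); §7.3 (degree-`3` isogenies, `ℚ(√3)`): "The
  proof follows the same lines as §6.4", §7.4 (very general `ρ = 10` via a member with
  `ρ(X ⊗ 𝔽̄₇) = 10`).

## Rendering (real carriers; the idiom of `K3Surface.Buskin2019_hodgeIsometry_algebraic` and
`K3ComplexMultiplication.HasComplexMultiplication`)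

The explicit Weierstrass families cannot be named over the tree's abstract `Motives.SchemeOver ℂ` /
`IsK3Surface`, so each family is vendored as the EXISTENCE of a member with the printed very general
invariants — a special case of the printed statement (`TODO(general form)` below). For a K3 surface
`S` (`IsK3Surface S`), `H²(S,ℚ) = NS_ℚ ⊕ T_ℚ` with `T_ℚ` an irreducible Hodge structure carrying
`H^{2,0}` (Huybrechts, *K3*, Lemma 3.3.1), so `End_Hod(T_ℚ)` embeds in `ℂ` by its action `ε` on a
non-zero `(2,0)`-class `σ` (Cor. 3.3.6), every rational Hodge endomorphism `ψ` of `H²` acts on `σ` by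
`ε(pr_T ψ|_T)`, and every element of `End_Hod(T_ℚ)` extends by `0` on `NS` to such a `ψ`. Hence
"`End_Hod(T_{S,ℚ}) = F = ℚ(θ)`, `θ ∈ ℝ`" is rendered as: the eigenvalues on `σ` of the rational
Hodge endomorphisms of `H²(S(ℂ); ℂ)` (complex-linear maps preserving rational classes and Hodge
types) all lie in `ℚ(θ) = {f(θ) : f ∈ ℚ[X]} ⊂ ℝ ⊂ ℂ`, together with ONE rational Hodge endomorphism
`t` with `t σ = θ σ` — here the one induced, through the correspondence action
`x ↦ pr_{1*}(pr₂^* x ∪ γ)` of the tree (`HodgeTheory.complexGysin` along `fst`, `cupProduct`,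
`complexBetti.map snd`; Voisin II (10.7)), by an ALGEBRAIC class `γ ∈ algebraicClasses (S ⊗ S) 2`
(the class of the printed cycle: the image of `Γ₁+Γ₋₁`, resp. the closure of the graph of the
rational self-map). `ρ(S)` is `Module.finrank ℂ (algebraicClasses S 1)` (the `ℂ`-span of the divisor
classes, of dimension `ρ`), as in `stmt-HodgeConjecture-19652`. The generator: `θ = 2cos(2πk/n)`
for some `k` coprime to `n` (`= ε(ζ_nᵏ+ζ_n⁻ᵏ)`, the embedding `ε` being the one through `H^{2,0}`;
which `k` is not printed), resp. `θ² = d` (`θ = ±√d`). As in `Buskin2019_hodgeIsometry_algebraic`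
the orientation family `μ` of the Gysin maps is universally quantified (a sign change of `μ` is
absorbed by `γ ↦ −γ`).

## NOT here / TODO(general form)

(i) The statements for EVERY (very general) member of the printed families (not expressible without
the Weierstrass models); (ii) Thm. 1.1 (5) (the degree-2 double-plane family `𝓐_p` of §5.9, `ρ = 2`)
— §4.8 is printed for the elliptic `𝓔_a`, so only the elliptic `n = 5` family of §5.2 (`ρ = 6`) is
vendored with the cycle clause; (iii) the consumer's normalisation "`t` kills `NS`" (replace `γ` by
its composite with the algebraic projector `Δ − Σ Dᵢ × Dᵢ^∨` onto `T`; Fulton, *Intersection Theory*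
§16.1) is NOT printed and not asserted; (iv) maximality / dimensions of the families; (v) nothing is
asserted (`def … : Prop`, no `_holds`); the Hodge conjecture is not advanced by this file.
FLAG `vGS-§4.8-n9`: for `n = 9` (§5.6: "one modifies the proof of Proposition 4.6") §4.8's sentence
is read with `n = 9` (same `D₉`-cover `𝓔̃_a`, same graphs `Γ_{±1}`). FLAG `vGS-§7.3-same-lines`: for
`ℚ(√3)` the action of the degree-`3` self-map on `ω` by `±√3` is "the same lines as §6.4", not
displayed.

## Tree search

`lean search 'GeemenSchutt|RealMultiplication|2310.05196'`: the paper is cited in route texts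
(`Summits/HodgeConjecture/…/Theses/NikulinTwinTransport.lean`) and its maximal-family Thm. 3.10 in
prose only; no declaration vendors Thm. 1.1/1.2 or §4.8. REUSED: `IsK3Surface`,
`HodgeTheory.complexGysin`, `HodgeTheory.OrientationFamily.HasPoincareDuality`, `algebraicClasses`,
`IsRationalClass`, `IsOfHodgeType`, `cupProduct`, `complexBetti.map` (all as in
`Buskin2019_hodgeIsometry_algebraic`).

## References

* [GeemenSchutt2023] B. van Geemen, M. Schütt, Forum Math. Sigma 13 (2025) e2, arXiv:2310.05196:
  Thm. 1.1, Thm. 1.2, Prop. 4.6, §4.8, Rem. 4.9, §5.2, §5.4, §5.6, §5.8, Prop. 6.2, §6.4, Prop. 7.2,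
  §7.3–7.4.
* [Huybrechts2016K3] D. Huybrechts, *Lectures on K3 surfaces*, Lemma 3.3.1, Cor. 3.3.6, Thm. 3.3.7
  (`T_ℚ` irreducible; `End_Hod(T_ℚ) ↪ ℂ`; totally real or CM).
* [VoisinHodgeII2003] C. Voisin, *Hodge Theory and Complex Algebraic Geometry II*, §9.2.2 and (10.7)
  (action of a correspondence `pr_{1*}(pr₂^* · ∪ [Z])`).
-/

noncomputable section

open CategoryTheory
open Literature.AlgebraicTopology.SingularHomology

namespace Literature.AlgebraicGeometry.Surfaces

/-- **The action on `H²(S(ℂ); ℂ)` of a class `γ ∈ H⁴((S × S)(ℂ); ℂ)` on the self-product of a K3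
surface**, `x ↦ pr_{1*}(pr₂^* x ∪ γ)` (Voisin II (10.7): "`α^*(β) = pr_{1*}(pr₂^*(β) ∪ α)`"), with the
tree's Gysin morphism `complexGysin μ` along `fst : S ⊗ S ⟶ S` (relative to the orientation family
`μ`), cup product and pull-back along `snd` — literally the expression of
`Buskin2019_hodgeIsometry_algebraic` with `S' = S`. [cite: VoisinHodgeII2003, §9.2.2 and (10.7)] -/
def k3SquareCorrAct (μ : HodgeTheory.OrientationFamily) {S : Motives.SchemeOver ℂ} (hS : IsK3Surface S)
    (γ : HodgeTheory.complexBetti (MonoidalCategoryStruct.tensorObj S S) (2 * 2))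
    (x : HodgeTheory.complexBetti S (2 * 1)) : HodgeTheory.complexBetti S (2 * 1) :=
  HodgeTheory.complexGysin μ (Motives.IsSmoothProjective.tensor_holds hS.1 hS.1) hS.1
    (SemiCartesianMonoidalCategory.fst S S)
    (rfl : 2 * 1 + 2 * 2 + 2 * 2 = 2 * 1 + 2 * (2 + 2))
    (cupProduct (rfl : 2 * 1 + 2 * 2 = 2 * 1 + 2 * 2)
      (HodgeTheory.complexBetti.map (SemiCartesianMonoidalCategory.snd S S) (2 * 1) x) γ)

/-- Unfolding of `k3SquareCorrAct`: `γ^*(x) = fst_* (snd^* x ∪ γ)`. [cite: VoisinHodgeII2003, §9.2.2 and (10.7)] -/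
theorem k3SquareCorrAct_apply (μ : HodgeTheory.OrientationFamily) {S : Motives.SchemeOver ℂ}
    (hS : IsK3Surface S) (γ : HodgeTheory.complexBetti (MonoidalCategoryStruct.tensorObj S S) (2 * 2))
    (x : HodgeTheory.complexBetti S (2 * 1)) :
    k3SquareCorrAct μ hS γ x =
      HodgeTheory.complexGysin μ (Motives.IsSmoothProjective.tensor_holds hS.1 hS.1) hS.1
        (SemiCartesianMonoidalCategory.fst S S)
        (rfl : 2 * 1 + 2 * 2 + 2 * 2 = 2 * 1 + 2 * (2 + 2))
        (cupProduct (rfl : 2 * 1 + 2 * 2 = 2 * 1 + 2 * 2)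
          (HodgeTheory.complexBetti.map (SemiCartesianMonoidalCategory.snd S S) (2 * 1) x) γ) :=
  rfl

/-- **Rendering predicate: "`S` is a (projective) K3 surface of Picard number `ρ` with real
multiplication `End_Hod(T_{S,ℚ}) = ℚ(θ)`, `θ ∈ ℝ`, whose generator `θ` is induced by an algebraic
cycle on `S × S`"** (van Geemen–Schütt §1: "`F = End_Hod(T_{X,ℚ})`"; §4.8: "the action of
`ζ_n+ζ_n⁻¹` … is induced by the cycle `Γ₁+Γ₋₁`"). On the real carriers (module docstring): `S` is a
K3 surface; `dim_ℂ` of the span of its divisor classes is `ρ`; there is a non-zero class `σ` of type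
`(2,0)` such that (a) every rational Hodge endomorphism `ψ` of `H²(S(ℂ); ℂ)` acts on `σ` by a scalar
`f(θ)`, `f ∈ ℚ[X]` (i.e. `ε(End_Hod T_ℚ) ⊆ ℚ(θ)`, Huybrechts Cor. 3.3.6), and (b) some algebraic
class `γ ∈ algebraicClasses (S ⊗ S) 2` acts through the correspondence action
`k3SquareCorrAct μ` (relative to the orientation family `μ`) as a rational Hodge endomorphism with
eigenvalue `θ` on `σ` (so `ε(End_Hod T_ℚ) = ℚ(θ)`, generated by an ALGEBRAIC class).
[cite: GeemenSchutt2023, §1 (definition of RM by F, before Thm. 1.1) and §4.8]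
[cite: Huybrechts2016K3, Lemma 3.3.1 and Cor. 3.3.6] -/
def IsK3WithRealMultiplicationByCycle (μ : HodgeTheory.OrientationFamily) (S : Motives.SchemeOver ℂ)
    (ρ : ℕ) (θ : ℝ) : Prop :=
  ∃ hS : IsK3Surface S,
    Module.finrank ℂ ↥(HodgeTheory.algebraicClasses S 1) = ρ ∧
    ∃ σ : HodgeTheory.complexBetti S (2 * 1),
      HodgeTheory.IsOfHodgeType 2 S (2 * 1) 2 0 σ ∧ σ ≠ 0 ∧
      (∀ ψ : HodgeTheory.complexBetti S (2 * 1) →ₗ[ℂ] HodgeTheory.complexBetti S (2 * 1),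
        (∀ c, HodgeTheory.IsRationalClass c → HodgeTheory.IsRationalClass (ψ c)) →
        (∀ (p q : ℕ) (c : HodgeTheory.complexBetti S (2 * 1)),
          HodgeTheory.IsOfHodgeType 2 S (2 * 1) p q c → HodgeTheory.IsOfHodgeType 2 S (2 * 1) p q (ψ c)) →
        ∃ f : Polynomial ℚ, ψ σ = ((Polynomial.aeval θ f : ℝ) : ℂ) • σ) ∧
      ∃ γ ∈ HodgeTheory.algebraicClasses (MonoidalCategoryStruct.tensorObj S S) 2,
        (∀ x, HodgeTheory.IsRationalClass x → HodgeTheory.IsRationalClass (k3SquareCorrAct μ hS γ x)) ∧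
        (∀ (p q : ℕ) (x : HodgeTheory.complexBetti S (2 * 1)),
          HodgeTheory.IsOfHodgeType 2 S (2 * 1) p q x →
            HodgeTheory.IsOfHodgeType 2 S (2 * 1) p q (k3SquareCorrAct μ hS γ x)) ∧
        k3SquareCorrAct μ hS γ σ = ((θ : ℝ) : ℂ) • σ

/-- Unfolding of `IsK3WithRealMultiplicationByCycle`. [cite: GeemenSchutt2023, §1 and §4.8] -/
theorem isK3WithRealMultiplicationByCycle_iff (μ : HodgeTheory.OrientationFamily)
    (S : Motives.SchemeOver ℂ) (ρ : ℕ) (θ : ℝ) :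
    IsK3WithRealMultiplicationByCycle μ S ρ θ ↔
      ∃ hS : IsK3Surface S,
        Module.finrank ℂ ↥(HodgeTheory.algebraicClasses S 1) = ρ ∧
        ∃ σ : HodgeTheory.complexBetti S (2 * 1),
          HodgeTheory.IsOfHodgeType 2 S (2 * 1) 2 0 σ ∧ σ ≠ 0 ∧
          (∀ ψ : HodgeTheory.complexBetti S (2 * 1) →ₗ[ℂ] HodgeTheory.complexBetti S (2 * 1),
            (∀ c, HodgeTheory.IsRationalClass c → HodgeTheory.IsRationalClass (ψ c)) →
            (∀ (p q : ℕ) (c : HodgeTheory.complexBetti S (2 * 1)),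
              HodgeTheory.IsOfHodgeType 2 S (2 * 1) p q c →
                HodgeTheory.IsOfHodgeType 2 S (2 * 1) p q (ψ c)) →
            ∃ f : Polynomial ℚ, ψ σ = ((Polynomial.aeval θ f : ℝ) : ℂ) • σ) ∧
          ∃ γ ∈ HodgeTheory.algebraicClasses (MonoidalCategoryStruct.tensorObj S S) 2,
            (∀ x, HodgeTheory.IsRationalClass x →
              HodgeTheory.IsRationalClass (k3SquareCorrAct μ hS γ x)) ∧
            (∀ (p q : ℕ) (x : HodgeTheory.complexBetti S (2 * 1)),
              HodgeTheory.IsOfHodgeType 2 S (2 * 1) p q x →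
                HodgeTheory.IsOfHodgeType 2 S (2 * 1) p q (k3SquareCorrAct μ hS γ x)) ∧
            k3SquareCorrAct μ hS γ σ = ((θ : ℝ) : ℂ) • σ :=
  Iff.rfl

/-- **van Geemen–Schütt, Thm. 1.1 (7), (9), (11) and §5.2, with Prop. 4.6 and §4.8: the elliptic
dihedral-cover families `𝓔_a` — K3 surfaces with real multiplication by `ℚ(ζ_n+ζ_n⁻¹)`,
`n ∈ {5, 7, 9, 11}`, of very general Picard number `6, 4, 10, 2` respectively, whose real
multiplication `ζ_n+ζ_n⁻¹` is induced by the algebraic cycle image of `Γ₁+Γ₋₁` (graphs of `σ^{±1}`,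
`σ` the order-`n` automorphism of the `D_n`-cover `𝓔̃_a`).** Printed: Thm. 1.1 "(7) … has `ρ = 4`
and RM by the cubic field `ℚ(ζ₇+ζ₇⁻¹)`. (9) … has `ρ = 10` and RM by the cubic field `ℚ(ζ₉+ζ₉⁻¹)`.
(11) … has `ρ = 2` and RM by the degree five field `ℚ(ζ₁₁+ζ₁₁⁻¹)`"; §5.2: "`ℚ(√5) ⊂ End_Hod(T_{X_a,ℚ})`
… this is an equality very generally" with very general `ρ = 6`; §4.8: "the action of `ζ_n+ζ_n⁻¹` on
`H²(𝓔̃_a, ℚ)` is induced by the cycle `Γ₁+Γ₋₁` on `𝓔̃_a × 𝓔̃_a`. This cycle induces one on `𝓔_a × 𝓔_a`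
which defines the real multiplication on `T_{X,ℚ}`." RENDERED (module docstring) as the existence,
for each `n`, of a K3 surface `S` and `k` coprime to `n` with
`IsK3WithRealMultiplicationByCycle μ S ρ (2cos(2πk/n))` (`2cos(2πk/n) = ε(ζ_nᵏ+ζ_n⁻ᵏ)` generates
`ℚ(ζ_n+ζ_n⁻¹) ⊂ ℝ`), for every orientation family `μ` with Poincaré duality. A SPECIAL CASE of the
printed statement (one very general member per family). Flag `vGS-§4.8-n9` (module docstring).
Nothing is asserted; no `_holds` is expected. TODO(general form): every very general member; Thm.
1.1 (5) (double planes, `ρ = 2`). [cite: GeemenSchutt2023, Thm. 1.1 (7) (9) (11), Prop. 4.6, §4.8, §5.2, §5.4, §5.6, §5.8] -/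
def GeemenSchutt2023_exists_K3_cyclotomicRealMultiplication_inducedByCycle : Prop :=
  ∀ μ : HodgeTheory.OrientationFamily, μ.HasPoincareDuality →
    (∃ (S : Motives.SchemeOver ℂ) (k : ℕ), Nat.Coprime k 5 ∧
        IsK3WithRealMultiplicationByCycle μ S 6 (2 * Real.cos (2 * Real.pi * (k : ℝ) / 5))) ∧
    (∃ (S : Motives.SchemeOver ℂ) (k : ℕ), Nat.Coprime k 7 ∧
        IsK3WithRealMultiplicationByCycle μ S 4 (2 * Real.cos (2 * Real.pi * (k : ℝ) / 7))) ∧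
    (∃ (S : Motives.SchemeOver ℂ) (k : ℕ), Nat.Coprime k 9 ∧
        IsK3WithRealMultiplicationByCycle μ S 10 (2 * Real.cos (2 * Real.pi * (k : ℝ) / 9))) ∧
    (∃ (S : Motives.SchemeOver ℂ) (k : ℕ), Nat.Coprime k 11 ∧
        IsK3WithRealMultiplicationByCycle μ S 2 (2 * Real.cos (2 * Real.pi * (k : ℝ) / 11)))

/-- **van Geemen–Schütt, Thm. 1.2 with Prop. 6.2 / §6.4 and Prop. 7.2 / §7.3–7.4: the isogeny
families — elliptic K3 surfaces of very general Picard number `10` with real multiplication by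
`ℚ(√2)`, resp. `ℚ(√3)`, induced by a rational self-map of degree `2`, resp. `3`.** Printed: Thm. 1.2
"(2) The 4-dimensional family of elliptic K3 surfaces in Proposition 6.2 has `ρ = 10` and RM by
`ℚ(√2)`. (3) The 3-dimensional family of elliptic K3 surfaces in Proposition 7.2 has `ρ = 10` and RM
by `ℚ(√3)`"; §6: "in order to find K3 surfaces with RM (induced by suitable rational self-maps)";
§6.4: "we obtain a self-map `φ'∘ψ` of `X` of degree `2` … `ℚ(√2) ⊂ End_Hod(T_X)` by inspection of
the degree `2` self-map `φ'∘ψ` of `X` and its induced action on `ω`" (`ω ↦ √2·ω`); §7.3: "The proof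
follows the same lines as §6.4" (flag `vGS-§7.3-same-lines`). RENDERED (module docstring) as the
existence of a K3 surface `S` and `θ ∈ ℝ` with `θ² = 2`, resp. `θ² = 3`, and
`IsK3WithRealMultiplicationByCycle μ S 10 θ` — the inducing algebraic class being that of the closure
of the graph of the rational self-map (the "induced action" of a rational map on cohomology is the
action of its graph as a correspondence, Voisin II §9.2.2). A SPECIAL CASE of the printed statement
(one very general member per family). Nothing is asserted; no `_holds` is expected.
TODO(general form): every very general member. [cite: GeemenSchutt2023, Thm. 1.2, Prop. 6.2, §6.4, Prop. 7.2, §7.3–7.4]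
[cite: VoisinHodgeII2003, §9.2.2] -/
def GeemenSchutt2023_exists_K3_quadraticRealMultiplication_inducedBySelfMap : Prop :=
  ∀ μ : HodgeTheory.OrientationFamily, μ.HasPoincareDuality →
    (∃ (S : Motives.SchemeOver ℂ) (θ : ℝ), θ ^ 2 = 2 ∧ IsK3WithRealMultiplicationByCycle μ S 10 θ) ∧
    (∃ (S : Motives.SchemeOver ℂ) (θ : ℝ), θ ^ 2 = 3 ∧ IsK3WithRealMultiplicationByCycle μ S 10 θ)

end Literature.AlgebraicGeometry.Surfaces

end
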